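/-
Copyright (c) 2026 the pub-hodgecm-mathlib formalisation cell (harness21).  Prover seat hodgecm-mathlib-LH4-p13 (g5), req620 Track A «(D-RAM) FOUR-FRAME» squad, unit U2H:
the (ρ2b′-X) child `stub_U2H_fixedPointCensus_typeTwo_unit0` (U2H ED. 15 :418) — organ **O-Sign** of LH4-p14's RHO2BX-ORDER v1 (released to this seat by F0P3a-p01 (g32)
2026-09-04T04:28Z; dealer LH4-plan (g12) WORD #22∕#23).  2026-09-04.
-/
import Literature.NumberTheory.Rogawski1990.RamifiedPlaceNormSymbolDichotomy        -- ★ `hilbertSymbol_eq_one_iff_exists_norm_toPlace` ((y, θ)_v = 1 ⟺ y ∈ N(L_w))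
import Literature.NumberTheory.LocalFields.WildQuadraticDatumNormSignConductor       -- ★ `exists_mul_map_eq_of_fixed_of_v_sub_one_le_pred` (fixed units ≡ 1 (ϖ^{2d−1}) are norms); brings ★ `IsRamifiedQuadraticDatum`
import Literature.NumberTheory.Automorphic.RamifiedPlaceEisensteinBasis              -- ★ `valued_toPlace_eq_sq_of_ramified` (|ι_w y| = |y|²)
import Literature.NumberTheory.Automorphic.UnitaryGroupInertPlaceHyperbolicBasis     -- ★ `exists_toPlace_eq_of_galAdicCompletionMap_eq` (σ_w-fixed ⇒ from L⁺_v)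
import Literature.NumberTheory.LocalFields.CompleteValuedSquareRootNearOne           -- ★ `exists_mul_self_eq_of_valued_sub_one_lt_four_adicCompletion` (√ near 1)
import Literature.NumberTheory.QuadraticForms.HilbertSymbolUnramifiedClassSub        -- ★ p857408 (this seat, file α): `hilbertSymbol_sub_eq_one_iff_of_unramifiedClass`
import Literature.NumberTheory.QuadraticForms.HilbertSymbolBilinear                  -- ★ bimultiplicativity of `(·,·)_v`
import HarnessLib

/-!
# Crux `H413`, line LH4 «(D-RAM) FOUR-FRAME» — unit U2H, (ρ2b′-X): organ O-Sign — THE SIGN LAW OF THE WILD TYPE-(2) TOKEN, TYPE U: `(β, θ)_v = (−1)^{m + d}`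

Cell `hodgecm-mathlib` (D-0151), FLOOR 0, crux item H413 = `stmt-HodgeConjecture-24833`, route of record `HCCMUnconditional`; squad F0∕P3c∕LH4; registered stub served:
`F0P3cDyRamFourFrameU2H.stub_U2H_fixedPointCensus_typeTwo_unit0` ((ρ2b′-X), U2H ED. 15 :418) through LH4-p14's ★ spine (layers 1 ∘ 3′ ∘ 4′, `hOrgNV`): this file pays the
**[tokens ∕ O-Sign] clause** of `hOrgNV` for TYPE U in closed form.  THEOREMS ONLY (no `def`, no instance, no notation, no `sorry`); lane `--supports stmt-HodgeConjecture-24833`.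
THE MATHEMATICS (Rogawski 1990 §4.9 p. 55, Lemma 4.9.3 p. 56; Labesse–Langlands 1979 §2).  At a non-split wild ramified `w ∣ v` (datum ★ `IsRamifiedQuadraticDatum σ_w ϖ d t_E`), for
`γ_H = (g, u)` with `w`-coordinates `u ∈ L_w¹`, `D = det g_w`, `χ = χ_g(u)_w ≠ 0`, and `δ ∈ L_w¹` with `δ² = D`, the ★ p856257 token `β` (`ι β = −χ(u² + D)∕(2u²D)`) FACTORS:
**`β = x·y`**, `ι x = −χ∕(uδ) = Tr_{K∕F}λ′ − Tr_{E∕F}u′` (`|x|_v = exp(−m)`), `ι y = (u′ + 1∕u′)∕2` (`u′ = u∕δ`, `λ′ = λ∕δ`); `x = a − b`, `ι a = (u² + D − χ)∕(uδ) − 2 = Tr λ′ − 2`,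
`ι b = (u′ − 1)²∕u′ = θ·c²` (`ι c = (u′ − 1)∕(√θ·√u′)`, §1, §4).  §3: `(y, θ)_v = 1` once `|u′ − 1| ≤ |ϖ|^n`, `2d + t_E ≤ 2n + 1` (★ conductor lemma), so `(β, θ)_v = (x, θ)_v`;
§5 MAIN `hilbertSymbol_token_eq_one_iff_even`: if `a` is of UNRAMIFIED CLASS (TYPE U: `K = L⁺_v(λ′)` unramified) then by ★ file α (p857408) **`(β, θ)_v = 1 ⟺ m + d` even**
(`v_F(θ) ≡ d`, §2) — EXACTLY the sign `ε` of ★ `toricCensusSum_unr` on its realizable set, `t_E`-free.  Evidence: ℚ₂ symbol identity 3000∕3000; F0P3a-p01 (g32) E1 type-U rows: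
`eps = (−1)^{m+d}` on every deep row, census `sign(N₊ − N₋) = (−1)^{m+d}` on all 40 rows incl. every FLIP row.  INTERFACE (T6 head ∕ T3-E): discharge `hA` from the type-U frame
(`𝔩 := λ′ − ρλ′ ∈ K = Fix(Θρ)`, `𝔩² = a(a + 4)`; ★ Serre V §2 Prop. 3), supply `δ` (★ square roots near `1`); `s_y = +1` for the frame literal on `Φ₃`.  Types RK∕RM: separate organ.
HONEST LABEL.  Count-neutral helper; (ρ2b′-X) OPEN (sub-ledger «`t_E = 2` road», LEAD T19-02 (R-25)); `HC_CM` is proved only modulo the 7 printed citations (2 remaining named inputs: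
hLiu418 = `stmt-HodgeConjecture-24832`, h413 = `stmt-HodgeConjecture-24833`) until rung 0 closes.

## References
* [Rogawski1990] J. D. Rogawski, *Automorphic Representations of Unitary Groups in Three Variables*, Ann. of Math. Stud. 123 (1990), §4.9 p. 55, Lemma 4.9.3 p. 56; §4.3 (4.3.2) p. 43.
* [LabesseLanglands1979] J.-P. Labesse, R. P. Langlands, *L-indistinguishability for SL(2)*, Canad. J. Math. 31 (1979), §2 (2.1)–(2.2) pp. 8–10.
* [Serre1979] J.-P. Serre, *Local Fields*, GTM 67 (1979), Ch. V §2 Prop. 3, §3 Cor. 2–3; Ch. XIV §3–§4.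
* [Omeara1963] O. T. O'Meara, *Introduction to Quadratic Forms*, Grundlehren 117 (1963), §63B (63:10–63:13a).
-/

set_option autoImplicit false

noncomputable section

open NumberField IsDedekindDomain WithZero
open Literature.NumberTheory.Automorphic Literature.NumberTheory.Automorphic.UnitaryGroup Literature.NumberTheory.GaloisRepresentations
open Literature.NumberTheory.QuadraticForms Literature.NumberTheory.Rogawski1990
open Literature.NumberTheory.Automorphic.UnitaryThreeFourFrame Literature.NumberTheory.LocalFields.WildQuadraticDatum

namespace Summit.HodgeConjecture.HodgeConjecture.Cruxes.H413.F0P3cDyRamTokenSignUnr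

variable (L : Type) [Field L] [NumberField L] [IsCMField L] {v : HeightOneSpectrum (𝓞 ↥(maximalRealSubfield L))}
  (w : PlacesOver L v) (hw : IsCMField.complexConj L • w.1 = w.1)

/-! ## §1 A `σ_w`-anti-fixed square root of `θ` in `L_w`, and descent of `σ_w`-fixed elements -/

omit [IsCMField L] in
/-- The coercion `L → L_w` is the algebra map. [folklore] -/
private theorem coe_eq_algebraMap (x : L) : ((x : L) : w.1.adicCompletion L) = algebraMap L (w.1.adicCompletion L) x := by
  rw [IsDedekindDomain.HeightOneSpectrum.algebraMap_adicCompletion]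
  rfl

omit [IsCMField L] in
/-- The coercion `L⁺ → L⁺_v` is the algebra map. [folklore] -/
private theorem coe_eq_algebraMap_base (y : ↥(maximalRealSubfield L)) :
    ((y : ↥(maximalRealSubfield L)) : v.adicCompletion ↥(maximalRealSubfield L)) = algebraMap ↥(maximalRealSubfield L) (v.adicCompletion ↥(maximalRealSubfield L)) y := by
  rw [IsDedekindDomain.HeightOneSpectrum.algebraMap_adicCompletion]
  rfl

include hw in
/-- **`√θ ∈ L_w`, anti-fixed by `σ_w`**: `L = L⁺(√θ)` (★ `cmQuadraticGenerator_spec`: `θ = α²`, `c α = −α`), read in `L_w`: some `s ≠ 0` with `σ_w s = −s` and `s² = ι_w θ`.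
[cite: Rogawski1990, §4.9 p. 55] -/
theorem exists_antifixed_sq_eq_toPlace_cmQuadraticGenerator :
    ∃ s : w.1.adicCompletion L, s ≠ 0 ∧ galAdicCompletionMap (L := L) (IsCMField.complexConj L) hw s = -s ∧
      s ^ 2 = toPlace v w (algebraMap ↥(maximalRealSubfield L) (v.adicCompletion ↥(maximalRealSubfield L))
        ((cmQuadraticGenerator L : 𝓞 ↥(maximalRealSubfield L)) : ↥(maximalRealSubfield L))) := by
  obtain ⟨α, hα0, hcα, hsq⟩ := cmQuadraticGenerator_spec L
  refine ⟨((α : L) : w.1.adicCompletion L), ?_, ?_, ?_⟩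
  · rw [coe_eq_algebraMap]
    exact (map_ne_zero_iff _ (algebraMap L (w.1.adicCompletion L)).injective).2 hα0
  · rw [galAdicCompletionMap_coe_algEquiv (σ := IsCMField.complexConj L) (h := hw) (x := α), hcα, coe_eq_algebraMap, coe_eq_algebraMap, map_neg]
  · rw [← coe_eq_algebraMap_base, toPlace_coe, ← hsq, coe_eq_algebraMap L w α, coe_eq_algebraMap L w (α ^ 2), map_pow]

include hw in
/-- **Descent of `σ_w`-fixed elements**: `σ_w z = z ⇒ z = ι_w y` for some `y ∈ L⁺_v` (★ `exists_toPlace_eq_of_galAdicCompletionMap_eq`, non-split `w`). [cite: Serre1979, Ch. II §3] -/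
theorem exists_toPlace_eq_of_fixed (z : w.1.adicCompletion L) (hz : galAdicCompletionMap (L := L) (IsCMField.complexConj L) hw z = z) :
    ∃ y : v.adicCompletion ↥(maximalRealSubfield L), toPlace v w y = z := by
  haveI : Algebra.IsQuadraticExtension ↥(maximalRealSubfield L) L := IsCMField.isQuadraticExtension L
  exact exists_toPlace_eq_of_galAdicCompletionMap_eq (IsCMField.complexConj L) w (IsCMField.complexConj_ne_one L) hw z hz

/-! ## §2 The valuation of `θ` has the parity of `d` -/

/-- In `ℤᵐ⁰`: `x² = y²` with `x, y ≠ 0` forces `log x = log y`. [folklore] -/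
private theorem log_eq_of_sq_eq {x y : ℤᵐ⁰} (hx : x ≠ 0) (hy : y ≠ 0) (h : x ^ 2 = y ^ 2) : log x = log y := by
  have h2 := congrArg log h
  rw [log_pow, log_pow] at h2
  simp only [nsmul_eq_mul, Nat.cast_ofNat] at h2
  have hx' := exp_log hx
  have hy' := exp_log hy
  omega

include hw in
/-- **`v_F(θ) ≡ d (mod 2)`** at a ramified `w ∣ v` carrying the datum `(σ_w, ϖ, d, t_E)`: the `σ_w`-ANTI-fixed `s = √θ` times the anti-fixed `ϖ − σϖ` is fixed and non-zero, so has
even valuation (datum), while `|ϖ − σϖ| = |ϖ|^d`; hence `log|s|_w ≡ d` and `|ι θ|_w = |s|² = |θ|_v²` gives `log|θ|_v = log|s|_w`. [cite: Serre1979, Ch. III §6; Ch. V §3] -/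
theorem even_log_valued_cmQuadraticGenerator_iff (he : v.asIdeal.ramificationIdx' w.1.asIdeal ≠ 1)
    (ϖ : w.1.adicCompletion L) (d tE : ℕ) (hD : IsRamifiedQuadraticDatum (galAdicCompletionMap (L := L) (IsCMField.complexConj L) hw) ϖ d tE) :
    Even (log (Valued.v (algebraMap ↥(maximalRealSubfield L) (v.adicCompletion ↥(maximalRealSubfield L))
        ((cmQuadraticGenerator L : 𝓞 ↥(maximalRealSubfield L)) : ↥(maximalRealSubfield L))))) ↔ Even (d : ℤ) := by
  obtain ⟨hσσ, hσv, hϖ, hfix, hϖσ, hd1, -⟩ := hD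
  obtain ⟨s, hs0, hσs, hs2⟩ := exists_antifixed_sq_eq_toPlace_cmQuadraticGenerator L w hw
  set σ := galAdicCompletionMap (L := L) (IsCMField.complexConj L) hw with hσdef
  have hanti0 : ϖ - σ ϖ ≠ 0 := by
    intro h0
    have h := hϖσ
    rw [h0, map_zero, hϖ] at h
    exact pow_ne_zero d exp_ne_zero h.symm
  have hfix1 : σ (s * (ϖ - σ ϖ)) = s * (ϖ - σ ϖ) := by
    rw [map_mul, hσs, map_sub, hσσ]; ring
  obtain ⟨k, hk⟩ := hfix (s * (ϖ - σ ϖ)) hfix1 (mul_ne_zero hs0 hanti0)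
  have hvs : Valued.v s = exp (2 * k + d) := by
    rw [Valuation.map_mul, hϖσ, hϖ, ← exp_nsmul] at hk
    simp only [nsmul_eq_mul, mul_neg, mul_one] at hk
    have h : Valued.v s = exp (2 * k) * (exp (-(d : ℤ)))⁻¹ := by
      rw [← hk, mul_assoc, mul_inv_cancel₀ exp_ne_zero, mul_one]
    rw [h, ← exp_neg, neg_neg, ← exp_add]
  have hθv : Valued.v (toPlace v w (algebraMap ↥(maximalRealSubfield L) (v.adicCompletion ↥(maximalRealSubfield L))
      ((cmQuadraticGenerator L : 𝓞 ↥(maximalRealSubfield L)) : ↥(maximalRealSubfield L)))) =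
      Valued.v (algebraMap ↥(maximalRealSubfield L) (v.adicCompletion ↥(maximalRealSubfield L))
        ((cmQuadraticGenerator L : 𝓞 ↥(maximalRealSubfield L)) : ↥(maximalRealSubfield L))) ^ 2 :=
    valued_toPlace_eq_sq_of_ramified L v w hw he _
  rw [← hs2, Valuation.map_pow] at hθv
  have hθ0 : Valued.v (algebraMap ↥(maximalRealSubfield L) (v.adicCompletion ↥(maximalRealSubfield L))
      ((cmQuadraticGenerator L : 𝓞 ↥(maximalRealSubfield L)) : ↥(maximalRealSubfield L))) ≠ 0 := by
    intro h0
    rw [h0, zero_pow two_ne_zero, hvs, ← exp_nsmul] at hθv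
    exact exp_ne_zero hθv
  have hlog := log_eq_of_sq_eq ((Valuation.ne_zero_iff _).2 hs0) hθ0 hθv
  rw [← hlog, hvs, log_exp]
  constructor
  · rintro ⟨r, hr⟩; exact ⟨r - k, by omega⟩
  · rintro ⟨r, hr⟩; exact ⟨r + k, by omega⟩

/-! ## §3 Fixed units `≡ 1 (mod ϖ^{2d−1})` are norms: `(y, θ)_v = 1` near `1` -/

include hw in
/-- **`(y, θ)_v = 1` for `ι_w y ≡ 1 (mod ϖ^N)`, `N ≥ 2d − 1`**: such a `σ_w`-fixed unit is a norm `z·σz` (★ `exists_mul_map_eq_of_fixed_of_v_sub_one_le_pred`, Serre V §3 Cor. 3),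
and norms have symbol `+1` (★ `hilbertSymbol_eq_one_iff_exists_norm_toPlace`). [cite: Serre1979, Ch. V §3 Cor. 2–3; Ch. XIV §3] -/
theorem hilbertSymbol_eq_one_of_valued_toPlace_sub_one_le
    (ϖ : w.1.adicCompletion L) (d tE : ℕ) (hD : IsRamifiedQuadraticDatum (galAdicCompletionMap (L := L) (IsCMField.complexConj L) hw) ϖ d tE)
    {y : v.adicCompletion ↥(maximalRealSubfield L)} {N : ℕ} (hN : 2 * d - 1 ≤ N)
    (hy : Valued.v (toPlace v w y - 1) ≤ Valued.v ϖ ^ N) :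
    hilbertSymbol (v.adicCompletion ↥(maximalRealSubfield L)) y
      (algebraMap ↥(maximalRealSubfield L) (v.adicCompletion ↥(maximalRealSubfield L))
        ((cmQuadraticGenerator L : 𝓞 ↥(maximalRealSubfield L)) : ↥(maximalRealSubfield L))) = 1 := by
  have hϖ := hD.2.2.1
  have hd1 := hD.2.2.2.2.2.1
  have hN1 : 1 ≤ N := by omega
  have hlt : Valued.v (toPlace v w y - 1) < 1 := by
    refine lt_of_le_of_lt hy ?_
    rw [hϖ, ← exp_nsmul, ← exp_zero, exp_lt_exp]
    simp only [nsmul_eq_mul, mul_neg, mul_one, Left.neg_neg_iff]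
    exact_mod_cast hN1
  have hy0 : y ≠ 0 := by
    rintro rfl
    rw [map_zero, zero_sub, Valuation.map_neg, Valuation.map_one] at hlt
    exact lt_irrefl _ hlt
  obtain ⟨z, hz⟩ := exists_mul_map_eq_of_fixed_of_v_sub_one_le_pred hD (galAdicCompletionMap_toPlace (IsCMField.complexConj L) w w hw y) hN hy
  exact (hilbertSymbol_eq_one_iff_exists_norm_toPlace L v w hw hy0).2 ⟨z, by rw [mul_comm]; exact hz⟩

/-! ## §4 A norm-one square root near `1` -/

include hw in
/-- **`√u′ ∈ L_w¹` near `1`**: if `σu′·u′ = 1` and `|u′ − 1| < |4|` then `u′ = r²` with `σr·r = 1`, `|r − 1| < |2|` (★ square roots near `1`; `σr·r = ±1` and `−1` is excluded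
because `|σr·r − 1| < |2| = |−1 − 1|`). [cite: Serre1979, Ch. XIV §4] -/
theorem exists_normOne_sqrt (hσv : ∀ x, Valued.v (galAdicCompletionMap (L := L) (IsCMField.complexConj L) hw x) = Valued.v x)
    {u' : w.1.adicCompletion L} (hσu' : galAdicCompletionMap (L := L) (IsCMField.complexConj L) hw u' * u' = 1)
    (h4 : Valued.v (u' - 1) < Valued.v (4 : w.1.adicCompletion L)) :
    ∃ r : w.1.adicCompletion L, r * r = u' ∧ galAdicCompletionMap (L := L) (IsCMField.complexConj L) hw r * r = 1 ∧
      Valued.v (r - 1) < Valued.v (2 : w.1.adicCompletion L) := by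
  set σ := galAdicCompletionMap (L := L) (IsCMField.complexConj L) hw with hσdef
  obtain ⟨r, hrr, hr1⟩ := Literature.NumberTheory.LocalFields.exists_mul_self_eq_of_valued_sub_one_lt_four_adicCompletion L w.1 u' h4
  refine ⟨r, hrr, ?_, hr1⟩
  have hp2 : (σ r * r) * (σ r * r) = 1 := by
    calc (σ r * r) * (σ r * r) = σ (r * r) * (r * r) := by rw [map_mul]; ring
      _ = 1 := by rw [hrr, hσu']
  have hcases : σ r * r = 1 ∨ σ r * r = -1 := by
    have h : (σ r * r - 1) * (σ r * r + 1) = 0 := by linear_combination hp2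
    rcases mul_eq_zero.1 h with h | h
    · exact Or.inl (sub_eq_zero.1 h)
    · exact Or.inr (eq_neg_of_add_eq_zero_left h)
  rcases hcases with h | h
  · exact h
  · exfalso
    have h2le : Valued.v (2 : w.1.adicCompletion L) ≤ 1 := by
      have h := Valuation.map_add (Valued.v : Valuation (w.1.adicCompletion L) ℤᵐ⁰) (1 : w.1.adicCompletion L) 1
      rwa [Valuation.map_one, max_self, one_add_one_eq_two] at h
    have hr1' : Valued.v (r - 1) < 1 := lt_of_lt_of_le hr1 h2le
    have hσr1 : Valued.v (σ r - 1) = Valued.v (r - 1) := by rw [← hσv (r - 1), map_sub σ r 1, map_one σ]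
    have hlt : Valued.v (σ r * r - 1) < Valued.v (2 : w.1.adicCompletion L) := by
      have hsplit : σ r * r - 1 = (σ r - 1) * (r - 1) + ((σ r - 1) + (r - 1)) := by ring
      rw [hsplit]
      refine lt_of_le_of_lt (Valuation.map_add _ _ _) (max_lt ?_ (lt_of_le_of_lt (Valuation.map_add _ _ _) (max_lt (by rw [hσr1]; exact hr1) hr1)))
      rw [Valuation.map_mul, hσr1]
      calc Valued.v (r - 1) * Valued.v (r - 1) ≤ Valued.v (r - 1) * 1 := mul_le_mul_right (le_of_lt hr1') _
        _ < Valued.v (2 : w.1.adicCompletion L) := by rw [mul_one]; exact hr1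
    rw [h, show (-1 : w.1.adicCompletion L) - 1 = -2 by norm_num, Valuation.map_neg] at hlt
    exact lt_irrefl _ hlt

/-! ## §5 MAIN: the sign law `(β, θ)_v = (−1)^{m + d}` (type U) -/

omit [IsCMField L] in
/-- `σx·x = 1` with `σ` isometric ⇒ `|x| = 1`. [folklore] -/
private theorem valued_eq_one_of_map_mul_self {σ : w.1.adicCompletion L →+* w.1.adicCompletion L} (hσv : ∀ x, Valued.v (σ x) = Valued.v x)
    {x : w.1.adicCompletion L} (h : σ x * x = 1) : Valued.v x = 1 := by
  have hx0 : x ≠ 0 := fun h0 => by rw [h0, mul_zero] at h; exact zero_ne_one h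
  have h2 : Valued.v x ^ 2 = 1 ^ 2 := by
    rw [one_pow, sq]
    nth_rewrite 1 [← hσv x]
    rw [← Valuation.map_mul, h, Valuation.map_one]
  have hvx0 : Valued.v x ≠ 0 := (Valuation.ne_zero_iff _).2 hx0
  have hlog := log_eq_of_sq_eq hvx0 one_ne_zero h2
  rw [log_one] at hlog
  have h3 : exp (log (Valued.v x)) = Valued.v x := exp_log hvx0
  rw [hlog, exp_zero] at h3
  exact h3.symm

include hw in
/-- **O-Sign, TYPE U — THE SIGN LAW OF THE WILD TYPE-(2) TOKEN: `(β, θ)_v = 1 ⟺ m + d` even.**  At a non-split wild ramified place `w ∣ v` with datum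
`(σ_w, ϖ, d, t_E)` (★ `IsRamifiedQuadraticDatum`), let `u, D ∈ L_w` be norm-one (`σu·u = σD·D = 1` — the `w`-coordinates `u_w`, `det g_w` of a `γ_H = (g, u) ∈ H_v`), `χ ∈ L_w`
(`= χ_g(u)_w`), `δ ∈ L_w¹` a square root of `D`, and let `(m, β)` be the TOKENS of ★ `tokens_anyPlace_of_isLocalGRegular` in their own letters: `|χ|_w = |ι_w ϖ_F|^m` (`|ϖ_F|_v = exp(−1)`)
and `ι_w β = −χ·(u² + D)∕(2u²D)`.  Suppose `γ_H` is DEEP: `|u∕δ − 1|_w ≤ |ϖ|^n` with `2d + t_E ≤ 2n + 1` and `2t_E < n`; and TYPE U: the element `a ∈ L⁺_v` with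
`ι_w a = (u² + D − χ)∕(uδ) − 2` (`= Tr_{K∕F} λ′ − 2`, `λ′ = λ∕δ` the normalised eigenvalue) is non-zero and of UNRAMIFIED CLASS (`(y, a)_v = 1 ⟺ v(y)` even).  Then
  `(β, θ)_v = 1 ⟺ m + d` is even.
Proof: `β = x·y` with `ι x = −χ∕(uδ)` (`|x|_v = exp(−m)`), `ι y = (u′ + 1∕u′)∕2 ≡ 1 (mod ϖ^{2n−t_E})` a norm (§3), `x = a − θ·c²` with `ι c = (u′ − 1)∕(√θ·√u′)` (§1, §4), ★ file α, and
`v_F(θ) ≡ d` (§2).  This is the `[tokens ∕ O-Sign]` clause of `hOrgNV` (★ `latticeCensus_literals_of_signedCensusNV`) for type U with `ε = (−1)^{m+d}` = the sign of ★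
`toricCensusSum_unr` on its realizable set. [cite: Rogawski1990, §4.9 p. 55, Lemma 4.9.3 p. 56] [cite: LabesseLanglands1979, §2 (2.1)–(2.2)] [cite: Serre1979, Ch. V §3 Cor. 3; Ch. XIV §3–§4] -/
theorem hilbertSymbol_token_eq_one_iff_even (he : v.asIdeal.ramificationIdx' w.1.asIdeal ≠ 1)
    (ϖ : w.1.adicCompletion L) (d tE : ℕ) (hD : IsRamifiedQuadraticDatum (galAdicCompletionMap (L := L) (IsCMField.complexConj L) hw) ϖ d tE)
    {u D χ δ : w.1.adicCompletion L}
    (hσu : galAdicCompletionMap (L := L) (IsCMField.complexConj L) hw u * u = 1)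
    (hδ : δ * δ = D) (hσδ : galAdicCompletionMap (L := L) (IsCMField.complexConj L) hw δ * δ = 1)
    {n : ℕ} (hn : 2 * d + tE ≤ 2 * n + 1) (hn4 : 2 * tE < n) (hdeep : Valued.v (u / δ - 1) ≤ Valued.v ϖ ^ n)
    {ϖF : v.adicCompletion ↥(maximalRealSubfield L)} (hϖF : Valued.v ϖF = exp (-1 : ℤ))
    {m : ℕ} (hm : Valued.v χ = Valued.v (toPlace v w ϖF ^ m))
    {β : v.adicCompletion ↥(maximalRealSubfield L)} (hβ : toPlace v w β = -(χ * (u ^ 2 + D)) / (2 * u ^ 2 * D))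
    {a : v.adicCompletion ↥(maximalRealSubfield L)} (ha0 : a ≠ 0) (ha : toPlace v w a = (u ^ 2 + D - χ) / (u * δ) - 2)
    (hA : ∀ y : v.adicCompletion ↥(maximalRealSubfield L), y ≠ 0 →
      (hilbertSymbol (v.adicCompletion ↥(maximalRealSubfield L)) y a = 1 ↔ Even (log (Valued.v y)))) :
    hilbertSymbol (v.adicCompletion ↥(maximalRealSubfield L)) β
        (algebraMap ↥(maximalRealSubfield L) _ ((cmQuadraticGenerator L : 𝓞 ↥(maximalRealSubfield L)) : ↥(maximalRealSubfield L))) = 1 ↔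
      Even (m + d) := by
  haveI : CharZero (v.adicCompletion ↥(maximalRealSubfield L)) :=
    charZero_of_injective_algebraMap (algebraMap ↥(maximalRealSubfield L) (v.adicCompletion ↥(maximalRealSubfield L))).injective
  obtain ⟨hσσ, hσv, hϖ, hfix, hϖσ, hd1, h2t⟩ := hD
  set σ := galAdicCompletionMap (L := L) (IsCMField.complexConj L) hw with hσdef
  set θv : v.adicCompletion ↥(maximalRealSubfield L) :=
    algebraMap ↥(maximalRealSubfield L) _ ((cmQuadraticGenerator L : 𝓞 ↥(maximalRealSubfield L)) : ↥(maximalRealSubfield L)) with hθvdef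
  have hι : Function.Injective (toPlace v w) := (toPlace v w).injective
  have hvu : Valued.v u = 1 := valued_eq_one_of_map_mul_self L w hσv hσu
  have hvδ : Valued.v δ = 1 := valued_eq_one_of_map_mul_self L w hσv hσδ
  have hu0 : u ≠ 0 := fun h0 => by rw [h0, map_zero] at hvu; exact zero_ne_one hvu
  have hδ0 : δ ≠ 0 := fun h0 => by rw [h0, map_zero] at hvδ; exact zero_ne_one hvδ
  have hD0 : D ≠ 0 := by rw [← hδ]; exact mul_ne_zero hδ0 hδ0
  have hσu' : σ u = u⁻¹ := eq_inv_of_mul_eq_one_left hσu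
  have hσδ' : σ δ = δ⁻¹ := eq_inv_of_mul_eq_one_left hσδ
  have h20 : (2 : w.1.adicCompletion L) ≠ 0 := by
    rw [← map_ofNat (algebraMap L (w.1.adicCompletion L)) 2]; exact (map_ne_zero _).2 two_ne_zero
  have hιϖF0 : toPlace v w ϖF ≠ 0 := fun h0 => by
    have h := congrArg Valued.v h0
    rw [valued_toPlace_eq_sq_of_ramified L v w hw he, hϖF, map_zero, ← exp_nsmul] at h
    exact exp_ne_zero h
  have hχ0 : χ ≠ 0 := fun h0 => by
    have h := hm
    rw [h0, map_zero, Valuation.map_pow] at h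
    exact pow_ne_zero m ((Valuation.ne_zero_iff _).2 hιϖF0) h.symm
  have hθ0 : θv ≠ 0 := by
    rw [hθvdef, Ne, map_eq_zero_iff _ (algebraMap ↥(maximalRealSubfield L) (v.adicCompletion ↥(maximalRealSubfield L))).injective]
    exact fun h => not_isSquare_cmQuadraticGenerator L (by rw [h]; exact IsSquare.zero)
  set u' : w.1.adicCompletion L := u / δ with hu'def
  have hu'0 : u' ≠ 0 := div_ne_zero hu0 hδ0
  have hσU : σ u' * u' = 1 := by
    rw [hu'def, map_div₀, div_mul_div_comm, hσu, hσδ, div_one]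
  have hσU' : σ u' = u'⁻¹ := eq_inv_of_mul_eq_one_left hσU
  have hvu' : Valued.v u' = 1 := valued_eq_one_of_map_mul_self L w hσv hσU
  have h4 : Valued.v (u' - 1) < Valued.v (4 : w.1.adicCompletion L) := by
    refine lt_of_le_of_lt hdeep ?_
    rw [show (4 : w.1.adicCompletion L) = 2 * 2 by norm_num, Valuation.map_mul, h2t, hϖ, ← pow_add, ← exp_nsmul, ← exp_nsmul, exp_lt_exp]
    simp only [nsmul_eq_mul, mul_neg, mul_one, neg_lt_neg_iff]
    have h' : tE + tE < n := by omega
    exact_mod_cast h'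
  obtain ⟨r, hrr, hσr, hr1⟩ := exists_normOne_sqrt L w hw hσv hσU h4
  have hr0 : r ≠ 0 := fun h0 => by rw [h0, mul_zero] at hrr; exact hu'0 hrr.symm
  have hσr' : σ r = r⁻¹ := eq_inv_of_mul_eq_one_left hσr
  obtain ⟨s, hs0, hσs, hs2⟩ := exists_antifixed_sq_eq_toPlace_cmQuadraticGenerator L w hw
  obtain ⟨c, hc⟩ : ∃ c : v.adicCompletion ↥(maximalRealSubfield L), toPlace v w c = (u' - 1) / (s * r) := by
    refine exists_toPlace_eq_of_fixed L w hw _ ?_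
    rw [map_div₀, map_sub, map_one, map_mul, hσU', hσs, hσr', ← hrr]
    field_simp
    ring
  set b : v.adicCompletion ↥(maximalRealSubfield L) := θv * c ^ 2 with hbdef
  have hιb : toPlace v w b = (u' - 1) ^ 2 / u' := by
    rw [hbdef, map_mul, map_pow, hc, hθvdef, ← hs2, ← hrr]
    field_simp
  set x : v.adicCompletion ↥(maximalRealSubfield L) := a - b with hxdef
  have hιx : toPlace v w x = -χ / (u * δ) := by
    rw [hxdef, map_sub, hιb, ha, hu'def, ← hδ]
    field_simp
    ring
  have hx0 : x ≠ 0 := fun h0 => by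
    have h := hιx
    rw [h0, map_zero] at h
    exact div_ne_zero (neg_ne_zero.2 hχ0) (mul_ne_zero hu0 hδ0) h.symm
  have hab : a ≠ b := fun h => hx0 (sub_eq_zero.2 h)
  obtain ⟨y, hy⟩ : ∃ y : v.adicCompletion ↥(maximalRealSubfield L), toPlace v w y = (u' + u'⁻¹) / 2 := by
    refine exists_toPlace_eq_of_fixed L w hw _ ?_
    rw [map_div₀, map_add, map_inv₀, hσU', inv_inv, map_ofNat, add_comm]
  have hιy1 : toPlace v w y - 1 = (u' - 1) ^ 2 / (2 * u') := by rw [hy]; field_simp; ring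
  have htE2n : tE ≤ 2 * n := by omega
  have hvy1 : Valued.v (toPlace v w y - 1) ≤ Valued.v ϖ ^ (2 * n - tE) := by
    rw [hιy1, Valuation.map_div, Valuation.map_mul, Valuation.map_pow, h2t, hvu', mul_one, hϖ, ← exp_nsmul, ← exp_nsmul,
      div_eq_mul_inv, ← exp_neg]
    have h1 : Valued.v (u' - 1) ^ 2 ≤ exp (-(n : ℤ)) ^ 2 := by
      have h := hdeep
      rw [hϖ, ← exp_nsmul] at h
      simp only [nsmul_eq_mul, mul_neg, mul_one] at h
      exact pow_le_pow_left' h 2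
    calc Valued.v (u' - 1) ^ 2 * exp (-(tE • (-1 : ℤ))) ≤ exp (-(n : ℤ)) ^ 2 * exp (-(tE • (-1 : ℤ))) := by
          gcongr
      _ = exp ((2 * n - tE : ℕ) • (-1 : ℤ)) := by
          rw [← exp_nsmul, ← exp_add]
          congr 1
          simp only [nsmul_eq_mul, mul_neg, mul_one, neg_neg]
          push_cast [Nat.cast_sub htE2n]
          ring
  have hyθ : hilbertSymbol (v.adicCompletion ↥(maximalRealSubfield L)) y θv = 1 :=
    hilbertSymbol_eq_one_of_valued_toPlace_sub_one_le L w hw ϖ d tE ⟨hσσ, hσv, hϖ, hfix, hϖσ, hd1, h2t⟩ (by omega) hvy1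
  have hy0 : y ≠ 0 := by
    rintro rfl
    have h := hvy1
    rw [map_zero, zero_sub, Valuation.map_neg, Valuation.map_one, hϖ, ← exp_nsmul, ← exp_zero, exp_le_exp, nsmul_eq_mul] at h
    have h2 : (1 : ℤ) ≤ ((2 * n - tE : ℕ) : ℤ) := by omega
    have h3 : ((2 * n - tE : ℕ) : ℤ) * (-1 : ℤ) < 0 := by omega
    exact absurd h (not_le.2 h3)
  have hβxy : β = x * y := by
    apply hι
    rw [map_mul, hιx, hy, hu'def, hβ, ← hδ]
    field_simp
  have hβθ : hilbertSymbol (v.adicCompletion ↥(maximalRealSubfield L)) β θv =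
      hilbertSymbol (v.adicCompletion ↥(maximalRealSubfield L)) x θv := by
    rw [hβxy, hilbertSymbol_adicCompletion_mul_left ↥(maximalRealSubfield L) v hx0 hy0 hθ0, hyθ, mul_one]
  have hα := hilbertSymbol_sub_eq_one_iff_of_unramifiedClass ↥(maximalRealSubfield L) v ha0 hθ0 hbdef.symm.symm hab hA
  have hlogx : log (Valued.v x) = -(m : ℤ) := by
    have h1 : Valued.v (toPlace v w x) = Valued.v x ^ 2 := valued_toPlace_eq_sq_of_ramified L v w hw he x
    have h2 : Valued.v (toPlace v w x) = Valued.v (toPlace v w (ϖF ^ m)) := by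
      rw [hιx, Valuation.map_div, Valuation.map_neg, Valuation.map_mul, hvu, hvδ, mul_one, div_one, hm]
      simp only [map_pow]
    have h3 : Valued.v (toPlace v w (ϖF ^ m)) = Valued.v (ϖF ^ m) ^ 2 := valued_toPlace_eq_sq_of_ramified L v w hw he _
    have h4' : Valued.v x ^ 2 = Valued.v (ϖF ^ m) ^ 2 := by rw [← h1, h2, h3]
    have hϖFm0 : Valued.v (ϖF ^ m) ≠ 0 := by rw [Valuation.map_pow, hϖF]; exact pow_ne_zero _ exp_ne_zero
    rw [log_eq_of_sq_eq ((Valuation.ne_zero_iff _).2 hx0) hϖFm0 h4', Valuation.map_pow, hϖF, ← exp_nsmul, log_exp]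
    simp only [nsmul_eq_mul, mul_neg, mul_one]
  have hθpar : Even (log (Valued.v θv)) ↔ Even (d : ℤ) :=
    even_log_valued_cmQuadraticGenerator_iff L w hw he ϖ d tE ⟨hσσ, hσv, hϖ, hfix, hϖσ, hd1, h2t⟩
  rw [hβθ, show x = a - b from rfl, hα, show a - b = x from rfl, hlogx, Int.even_add, even_neg, hθpar, Int.even_coe_nat, Int.even_coe_nat,
    Nat.even_add]

include hw in
/-- **O-Sign, TYPE U, SIGNED FORM: `(β, θ)_v = (−1)^{m + d}`** (same hypotheses as ★ `hilbertSymbol_token_eq_one_iff_even`) — the letter consumed by `hOrgNV`'s `[tokens]` clause with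
`ε_t = (−1)^{m+d}·s_y`. [cite: Rogawski1990, §4.9 p. 55, Lemma 4.9.3 p. 56] [cite: LabesseLanglands1979, §2 (2.1)–(2.2)] -/
theorem hilbertSymbol_token_eq_neg_one_pow (he : v.asIdeal.ramificationIdx' w.1.asIdeal ≠ 1)
    (ϖ : w.1.adicCompletion L) (d tE : ℕ) (hD : IsRamifiedQuadraticDatum (galAdicCompletionMap (L := L) (IsCMField.complexConj L) hw) ϖ d tE)
    {u D χ δ : w.1.adicCompletion L}
    (hσu : galAdicCompletionMap (L := L) (IsCMField.complexConj L) hw u * u = 1)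
    (hδ : δ * δ = D) (hσδ : galAdicCompletionMap (L := L) (IsCMField.complexConj L) hw δ * δ = 1)
    {n : ℕ} (hn : 2 * d + tE ≤ 2 * n + 1) (hn4 : 2 * tE < n) (hdeep : Valued.v (u / δ - 1) ≤ Valued.v ϖ ^ n)
    {ϖF : v.adicCompletion ↥(maximalRealSubfield L)} (hϖF : Valued.v ϖF = exp (-1 : ℤ))
    {m : ℕ} (hm : Valued.v χ = Valued.v (toPlace v w ϖF ^ m))
    {β : v.adicCompletion ↥(maximalRealSubfield L)} (hβ : toPlace v w β = -(χ * (u ^ 2 + D)) / (2 * u ^ 2 * D))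
    {a : v.adicCompletion ↥(maximalRealSubfield L)} (ha0 : a ≠ 0) (ha : toPlace v w a = (u ^ 2 + D - χ) / (u * δ) - 2)
    (hA : ∀ y : v.adicCompletion ↥(maximalRealSubfield L), y ≠ 0 →
      (hilbertSymbol (v.adicCompletion ↥(maximalRealSubfield L)) y a = 1 ↔ Even (log (Valued.v y)))) :
    hilbertSymbol (v.adicCompletion ↥(maximalRealSubfield L)) β
        (algebraMap ↥(maximalRealSubfield L) _ ((cmQuadraticGenerator L : 𝓞 ↥(maximalRealSubfield L)) : ↥(maximalRealSubfield L))) = (-1) ^ (m + d) := by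
  have h := hilbertSymbol_token_eq_one_iff_even L w hw he ϖ d tE hD hσu hδ hσδ hn hn4 hdeep hϖF hm hβ ha0 ha hA
  rcases Nat.even_or_odd (m + d) with hev | hodd
  · rw [hev.neg_one_pow]; exact h.2 hev
  · rw [hodd.neg_one_pow]
    rcases hilbertSymbol_eq_one_or_eq_neg_one β
        (algebraMap ↥(maximalRealSubfield L) (v.adicCompletion ↥(maximalRealSubfield L)) ((cmQuadraticGenerator L : 𝓞 ↥(maximalRealSubfield L)) : ↥(maximalRealSubfield L))) with h1 | h1
    · exact absurd (h.1 h1) (Nat.not_even_iff_odd.2 hodd)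
    · exact h1

end Summit.HodgeConjecture.HodgeConjecture.Cruxes.H413.F0P3cDyRamTokenSignUnr

end
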